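import Literature.Probability.Percolation.MarkedLoopBoundarySpanSideways
import HarnessLib

/-!
# Boundary span from tightening and CAP DATA IN THE SPAN: the assembly criterion freed from the one-hexagon F1 («BSPAN-CAPINS-CRITERION»)

Topic `Literature/Probability/Percolation`; generic-`k` layer of the marked-loop (Khristoforov–Smirnov) lineage; a rider on `MarkedLoopBoundarySpanSideways.lean`
(«BSPAN-SIDEWAYS-CRITERION»: ★★ `bNonvanish_of_subfamily_stable_corners`, ★ `tlL_one_eq_sideways`, ★★★ `bNonvanish_of_tighten_sideways` — whose cap data are the TWO-TERM
differences `capInsL j X₀ = lawLP w_h − lawLP w` of the one-hexagon F1 identity).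

HOME `FINDING-TWO-CELL-CAP-IDENTITY.md` (b-engine-2 g24): Bollobás–Riordan marks allow at most ONE disorder on the outer path of one attached hexagon, so the one-hexagon F1 has
no `TriMarkedDomain` instance; its replacement, the TWO-CELL CAP IDENTITY, expresses `capInsL j X₀` as a signed sum of FOUR laws. This file restates the assembly so that ANY
expression of the cap data inside the span of the family's laws suffices:

* ★ `tlL_one_mem_of_capInsL_mem` — at loop weight `1`, if `contractL j L₀ = X₁ − X₀` and `capInsL j X₀`, `capInsL j X₁` lie in a subspace `W`, then `e_j L₀ ∈ W`
  (`e_j = capInsL j ∘ contractL j`); `capInsL_mem_of_eq_four` — the four-term form of the two-cell cap identity gives such membership;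
* ★★★ `bNonvanish_of_tighten_capIns` / `bSpan_of_tighten_capIns'` — **THE ASSEMBLY CRITERION WITH CAP DATA IN THE SPAN**: `T` a family of home-arc lawpoints of
  `(2m+1)`-marked domains with one realised pattern; if for every corner pair `j ≤ 2m−1` and every `z ∈ T` the law `lawLP z` lies in the span of the laws of those `w ∈ T`
  admitting `X₀, X₁` with `contractL j (lawLP w) = X₁ − X₀` (F2) and `capInsL j X₀, capInsL j X₁ ∈ span (lawLP T)` (any cap identity), then `BNonvanish (2m+1)` and `BSpan`
  hold on every arc. #744's `bNonvanish_of_tighten_sideways` is the special case of two-term cap data: its hypothesis implies this one by `capInsL_mem_of_eq_two` and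
  `Submodule.span_mono` (not restated here — it would be the tree statement verbatim).

## References
* M. Khristoforov, S. Smirnov, *Percolation and O(1) loop model*, arXiv:2111.15612 (2021), §1.2 (arXiv v1 p. 2), §2 Lemma 4 (p. 4), eq. (4) and Remark 6 (p. 5).
* D. Ridout, Y. Saint-Aubin, *Standard modules, induction and the structure of the Temperley–Lieb algebra*, Adv. Theor. Math. Phys. 18 (2014) = arXiv:1204.4505, §3
  Prop. 3.3 (arXiv p. 13).
* P. A. Pearce, V. Rittenberg, J. de Gier, B. Nienhuis, *Temperley–Lieb stochastic processes*, J. Phys. A 35 (2002) L661–L668, §2 (the monoid move `e_j`; cup–cap).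

## Mathlib / tree
Tree: `MarkedLoopBoundarySpanSideways` (`bNonvanish_of_subfamily_stable_corners`), `LatticeModels/TemperleyLiebCapContract` (`capInsL`, `contractL`,
`tlL_one_eq_capInsL_comp_contractL`), `MarkedLoopBoundaryLawModule` (`lawLP`), `MarkedLoopBoundarySpan` (`ArcPoint`, `BSpan`, `BNonvanish`, `bSpan_iff_bNonvanish`,
`bNonvanish_iff`). Mathlib: `Submodule.span_induction`, `Submodule.sub_mem`.
-/

open Finset

namespace Literature.Probability.Percolation.MarkedLoops

open Literature.Probability.Percolation Literature.Probability.LatticeModels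
open Literature.Probability.LatticeModels.TemperleyLieb
open TriMarkedDomain

/-! ### Cap data in a subspace -/

section CapIns

variable {R : Type*} [CommRing R] {n : ℕ}

/-- ★ **`e_j L₀` lies in any subspace containing the two cap data**: at loop weight `1`, `contractL j L₀ = X₁ − X₀`, `capInsL j X₀ ∈ W`, `capInsL j X₁ ∈ W` give `e_j L₀ ∈ W`.
[cite: PearceRittenbergDeGierNienhuis2002, §2 ((monoid): the cup–cap move `e_j`)] -/
theorem tlL_one_mem_of_capInsL_mem (j : Fin (n + 1)) {W : Submodule R (LinkPattern (n + 1 + 1) →₀ R)} {L₀ : LinkPattern (n + 1 + 1) →₀ R} {X₀ X₁ : LinkPattern n →₀ R}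
    (hF2 : contractL R j L₀ = X₁ - X₀) (h₀ : capInsL R j X₀ ∈ W) (h₁ : capInsL R j X₁ ∈ W) : tlL R (1 : R) j L₀ ∈ W := by
  rw [tlL_one_eq_capInsL_comp_contractL, LinearMap.comp_apply, hF2, map_sub]
  exact W.sub_mem h₁ h₀

/-- **the four-term cap identity gives cap data in the span**: `capInsL j X = L_ab − L_PQ − L_Pc − L_cQ` with the four laws in `W` puts `capInsL j X` in `W` (the shape of the
TWO-CELL CAP IDENTITY of HOME `FINDING-TWO-CELL-CAP-IDENTITY.md` §2). [cite: PearceRittenbergDeGierNienhuis2002, §2 ((monoid): the cup–cap)] -/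
theorem capInsL_mem_of_eq_four (j : Fin (n + 1)) {W : Submodule R (LinkPattern (n + 1 + 1) →₀ R)} {X : LinkPattern n →₀ R} {Lab LPQ LPc LcQ : LinkPattern (n + 1 + 1) →₀ R}
    (h : capInsL R j X = Lab - LPQ - LPc - LcQ) (hab : Lab ∈ W) (hPQ : LPQ ∈ W) (hPc : LPc ∈ W) (hcQ : LcQ ∈ W) : capInsL R j X ∈ W := by
  rw [h]
  exact W.sub_mem (W.sub_mem (W.sub_mem hab hPQ) hPc) hcQ

/-- the two-term (one-hexagon F1) form, for comparison: `capInsL j X = L_h − L` with both laws in `W`. [cite: PearceRittenbergDeGierNienhuis2002, §2 ((monoid): the cup–cap)] -/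
theorem capInsL_mem_of_eq_two (j : Fin (n + 1)) {W : Submodule R (LinkPattern (n + 1 + 1) →₀ R)} {X : LinkPattern n →₀ R} {Lh L : LinkPattern (n + 1 + 1) →₀ R}
    (h : capInsL R j X = Lh - L) (hh : Lh ∈ W) (hL : L ∈ W) : capInsL R j X ∈ W := by
  rw [h]
  exact W.sub_mem hh hL

end CapIns

/-! ### The assembly criterion with cap data in the span -/

section Assembly

variable {m : ℕ}

/-- ★★★ **BOUNDARY NON-DEGENERACY FROM TIGHTENING, F2 AND CAP DATA IN THE SPAN.** Let `T` be a family of home-arc lawpoints of `(2m+1)`-marked domains with one realised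
pattern. Suppose that for every corner pair `j ≤ 2m−1` and every `z ∈ T` the law `lawLP z` lies in the span of the laws of those members `w ∈ T` that admit vectors `X₀, X₁` of
the planar module of `2m` sites with `contractL j (lawLP w) = X₁ − X₀` (the one-hexagon contraction F2) and `capInsL j X₀`, `capInsL j X₁` in the span of the laws of `T` (ANY
cap identity: the two-cell cap identity's four terms, or the one-hexagon F1's two). Then `BNonvanish (2m+1)` on the home arc.
[cite: KhristoforovSmirnov2021, §2 Lemma 4 (arXiv v1 p. 4), eq. (4) and Remark 6 (p. 5); RidoutSaintAubin2014TL, §3 Prop. 3.3 (arXiv p. 13); PearceRittenbergDeGierNienhuis2002, §2] -/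
theorem bNonvanish_of_tighten_capIns (T : Set (Σ D : TriMarkedDomain (2 * m + 1), ArcPoint D (Fin.last (2 * m))))
    (h0 : ∃ zz : T, ∃ q : Pat₀ (2 * m + 1), patternCount zz.1.1 zz.1.2.v zz.1.2.i q.1 ≠ 0)
    (htight : ∀ (j : Fin (2 * m + 1)), j.val < 2 * m → ∀ zz : T,
      lawLP zz.1.2 ∈ Submodule.span ℂ (Set.range fun ww : {ww : T //
          ∃ (X₀ X₁ : LinkPattern (2 * m) →₀ ℂ), contractL ℂ j (lawLP ww.1.2) = X₁ - X₀ ∧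
            capInsL ℂ j X₀ ∈ Submodule.span ℂ (Set.range fun vv : T => lawLP vv.1.2) ∧
              capInsL ℂ j X₁ ∈ Submodule.span ℂ (Set.range fun vv : T => lawLP vv.1.2)} => lawLP ww.1.1.2)) :
    BNonvanish (2 * m + 1) (Fin.last (2 * m)) := by
  refine bNonvanish_of_subfamily_stable_corners T (fun j hj zz => ?_) h0
  set W := Submodule.span ℂ (Set.range fun ww : T => lawLP ww.1.2) with hW
  have key : ∀ x, x ∈ Submodule.span ℂ (Set.range fun ww : {ww : T //
      ∃ (X₀ X₁ : LinkPattern (2 * m) →₀ ℂ), contractL ℂ j (lawLP ww.1.2) = X₁ - X₀ ∧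
        capInsL ℂ j X₀ ∈ Submodule.span ℂ (Set.range fun vv : T => lawLP vv.1.2) ∧
          capInsL ℂ j X₁ ∈ Submodule.span ℂ (Set.range fun vv : T => lawLP vv.1.2)} => lawLP ww.1.1.2) → tlL ℂ 1 j x ∈ W := by
    intro x hx
    refine Submodule.span_induction ?_ ?_ ?_ ?_ hx
    · rintro _ ⟨⟨ww, X₀, X₁, hF2, hX₀, hX₁⟩, rfl⟩
      exact tlL_one_mem_of_capInsL_mem j hF2 hX₀ hX₁
    · rw [map_zero]; exact W.zero_mem
    · intro x y _ _ hx hy; rw [map_add]; exact W.add_mem hx hy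
    · intro c x _ hx; rw [map_smul]; exact W.smul_mem c hx
  exact key _ (htight j hj zz)

/-- ★★★ **… AND BOUNDARY SPAN ON EVERY ARC** (`k = 2m+3 ≥ 3`). [cite: KhristoforovSmirnov2021, §1.2 (arXiv v1 p. 2: cyclic indexing); §2 eq. (4) and Remark 6 (p. 5); RidoutSaintAubin2014TL, §3 Prop. 3.3 (arXiv p. 13)] -/
theorem bSpan_of_tighten_capIns' {m : ℕ} (T : Set (Σ D : TriMarkedDomain (2 * (m + 1) + 1), ArcPoint D (Fin.last (2 * (m + 1)))))
    (h0 : ∃ zz : T, ∃ q : Pat₀ (2 * (m + 1) + 1), patternCount zz.1.1 zz.1.2.v zz.1.2.i q.1 ≠ 0)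
    (htight : ∀ (j : Fin (2 * (m + 1) + 1)), j.val < 2 * (m + 1) → ∀ zz : T,
      lawLP zz.1.2 ∈ Submodule.span ℂ (Set.range fun ww : {ww : T //
          ∃ (X₀ X₁ : LinkPattern (2 * (m + 1)) →₀ ℂ), contractL ℂ j (lawLP ww.1.2) = X₁ - X₀ ∧
            capInsL ℂ j X₀ ∈ Submodule.span ℂ (Set.range fun vv : T => lawLP vv.1.2) ∧
              capInsL ℂ j X₁ ∈ Submodule.span ℂ (Set.range fun vv : T => lawLP vv.1.2)} => lawLP ww.1.1.2))
    (a : Fin (2 * (m + 1) + 1)) : BSpan (2 * (m + 1) + 1) a ∧ BNonvanish (2 * (m + 1) + 1) a := by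
  have h := bNonvanish_of_tighten_capIns T h0 htight
  have ha : BNonvanish (2 * (m + 1) + 1) a := (bNonvanish_iff (n := 2 * m + 1) a (Fin.last (2 * (m + 1)))).2 h
  exact ⟨(bSpan_iff_bNonvanish a).2 ha, ha⟩

end Assembly

end Literature.Probability.Percolation.MarkedLoops
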